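import Literature.NumberTheory.Automorphic.Liu2021.AlbaneseCocycleOfPieces
import Literature.NumberTheory.Automorphic.Liu2021.AlbaneseExistence
import Mathlib.AlgebraicGeometry.Morphisms.Flat
import Mathlib.RingTheory.RingHom.FaithfullyFlat
import HarnessLib

/-!
# Liu 2021 §2.1: every Albanese datum of a smooth projective scheme over a subfield of `ℂ` is a cocycle

[Liu2021] = Yifeng Liu, *Fourier–Jacobi cycles and arithmetic relative trace formula*, Camb. J. Math. **9** (2021)
= arXiv:2102.11518 (v2 numbering; `l. NNNN` = lines of `FJcycle.tex`).  Proof of the Proposition of §2.1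
(l. 1194–1200): split `X` over a finite Galois `k'/k`, «As `(∇X)_{k'} ≃ ∇_{k'}X'`», Serre's construction on the
pieces, «the statement for `X` then follows by Galois descent».  CONSEQUENCE PROVED HERE (piece P3b-2 of the discharge of
`AlbaneseTraceOfFiniteQuotient`, cell hodgecm-mathlib row VI-5): the cocycle identity `α(a,b) · α(b,c) = α(a,c)` of the
Albanese morphism (`AppendixC.Albanese.IsCocycle`, `AppendixC/AlbaneseCocycle.lean`) holds for EVERY Albanese datum
(Def. 2.3, corepresentability typing) of a scheme `X` smooth of some relative dimension and projective over a field
`k` of characteristic zero with `[Algebra k ℂ]` — the generality of the tree's Albanese MODEL (`Liu2021/AlbaneseExistence`).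

PROOF (ours): over the splitting field `L` every Albanese datum of `X_L` is a cocycle (`Albanese.isCocycle_of_isColimit`,
`Liu2021/AlbaneseCocycleOfPieces`, with Milne's data of the pieces from `Motives/AlbaneseExistenceSubfieldComplex`);
`(∇X)_L ≅ ∇(X_L)` OVER `X_L × X_L` (`Nabla.exists_of_nabla_baseChange_incl`, `Liu2021/NablaGaloisDescent`) carries base
changes of `T`-points of `∇X` over `(a,b)` to `T_L`-points of `∇(X_L)` over `(a_L,b_L)`; the base change `(α_X)_L` kills
`Δ(X_L)`, hence is a cocycle over `L` (`Albanese.IsCocycle.isCocycle_of_diag_comp`); base change along `Spec L → Spec k`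
is multiplicative on points (Mathlib `Functor.map_mul`) and FAITHFUL (`bcFunctor_map_injective`: the projection
`T_L → T` is flat and surjective, hence an epimorphism), so the identity descends.

* `bcFunctor_map_injective` — `f ↦ f_L` is injective on `k`-morphisms `T → Z`.
* `Nabla.IsCocycle.of_baseChange` — a morphism `β : ∇X → B` is a cocycle as soon as `(β)_L`, read on a `∇(X_L)`
  identified with `(∇X)_L` over `X_L × X_L`, is one.
* `Albanese.isCocycle_of_isProjectiveOver` — **the theorem.**

NOT claimed: the cocycle property over fields not embeddable in `ℂ` (it would follow from rigidity over `k̄` and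
`albanese_baseChange`; not needed by the COR-CM consumers, which live over CM number fields), transitivity of `∇X`,
the named fact (T).  HC_CM is NOT proved here; nothing discharges a COR-CM binder.  Ours; axioms `propext`,
`Classical.choice`, `Quot.sound`.

## References
* [Liu2021] Y. Liu, arXiv:2102.11518 = Camb. J. Math. 9 (2021), §2.1 Proposition with proof (l. 1190–1200),
  Def. 2.1 (1), Def. 2.3 (l. 1171–1208).
* [Milne1986JacobianVarieties] J. S. Milne, *Jacobian Varieties* (1986), Remark 1.9, §6 Prop. 6.4, Remark 6.5.
* [GortzWedhorn2020] U. Görtz, T. Wedhorn, *Algebraic Geometry I* (2nd ed. 2020), Thm. 14.72 (1), Def. 14.84.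
-/

noncomputable section

open CategoryTheory CategoryTheory.Limits AlgebraicGeometry MonoidalCategory CartesianMonoidalCategory
open Literature.AlgebraicGeometry.Motives

namespace Literature.NumberTheory.Automorphic.Liu2021.AppendixC

open AbelianVariety (bcSpec bcFunctor)

set_option backward.isDefEq.respectTransparency false

universe u

open scoped MonObj Obj

section Faithful

variable {k : Type u} [Field k] (L : Type u) [Field L] [Algebra k L] {T Z : SchemeOver k}

/-- **Base change along a field extension is faithful on morphisms of `k`-schemes**: if `f_L = g_L : T_L → Z_L`
then `f = g`.  The projection `T_L → T` is the base change of `Spec L → Spec k`, which is flat and surjective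
(`L` is faithfully flat over the field `k`), hence an epimorphism of schemes (Mathlib `Flat.epi_of_flat_of_surjective`),
and `pr ≫ f = f_L ≫ pr = g_L ≫ pr = pr ≫ g`.  [cite: GortzWedhorn2020, Thm. 14.72 (1)] -/
theorem bcFunctor_map_injective : Function.Injective ((bcFunctor k L).map : (T ⟶ Z) → _) := by
  intro f g hfg
  have h2 : pullback.fst T.hom (bcSpec k L) ≫ f.left = pullback.fst T.hom (bcSpec k L) ≫ g.left := by
    rw [← GaloisDescent.bcFunctor_map_left_comp_fst L f, hfg, GaloisDescent.bcFunctor_map_left_comp_fst L g]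
  have hff : (CommRingCat.ofHom (algebraMap k L)).hom.FaithfullyFlat := by
    rw [CommRingCat.hom_ofHom, RingHom.faithfullyFlat_algebraMap_iff]
    infer_instance
  obtain ⟨hflat, hsurj⟩ := (flat_and_surjective_SpecMap_iff _).2 hff
  haveI : Flat (pullback.fst T.hom (bcSpec k L)) := MorphismProperty.pullback_fst _ _ hflat
  haveI : Surjective (pullback.fst T.hom (bcSpec k L)) := MorphismProperty.pullback_fst _ _ hsurj
  haveI : Epi (pullback.fst T.hom (bcSpec k L)) := Flat.epi_of_flat_of_surjective _
  exact Over.OverMorphism.ext ((cancel_epi _).1 h2)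

end Faithful

section Descent

variable {k : Type u} [Field k] (L : Type u) [Field L] [Algebra k L] {X : SchemeOver k}

/-- **The cocycle identity descends along base change.**  Let `N` be a `∇X` over `k`, `β : ∇X → B` a morphism to an
abelian variety, `N'` a `∇(X_L)` and `e : (∇X)_L ≅ ∇(X_L)` an isomorphism over `X_L × X_L`
(`e ≫ incl' ≫ μ = incl_L`).  If `e⁻¹ ≫ β_L : ∇(X_L) → B_L` is a cocycle, so is `β`: base change carries `T`-points of
`∇X` over `(a,b)` to `T_L`-points of `∇(X_L)` over `(a_L, b_L)`, is multiplicative on points (Mathlib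
`Functor.map_mul`) and faithful (`bcFunctor_map_injective`).  Ours. [cite: Liu2021, §2.1 proof of the Proposition (l. 1194–1200)]
[cite: GortzWedhorn2020, Thm. 14.72 (1)] -/
theorem Nabla.IsCocycle.of_baseChange (N : Nabla X) {B : AbelianVariety k} (β : N.N ⟶ B.X)
    (N' : Nabla ((bcFunctor k L).obj X)) (e : (bcFunctor k L).obj N.N ≅ N'.N)
    (he : e.hom ≫ N'.incl ≫ Functor.LaxMonoidal.μ (bcFunctor k L) X X = (bcFunctor k L).map N.incl)
    (h : N'.IsCocycle (B := B.baseChange L) (e.inv ≫ (bcFunctor k L).map β)) : N.IsCocycle β := by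
  intro T a b c ab bc ac hab hbc hac
  have he' : e.hom ≫ N'.incl = (bcFunctor k L).map N.incl ≫ Functor.OplaxMonoidal.δ (bcFunctor k L) X X := by
    rw [← he, Category.assoc, Category.assoc, Functor.Monoidal.μ_δ, Category.comp_id]
  -- base-changed points of `∇(X_L)`
  have hpt : ∀ (u v : T ⟶ X) (uv : T ⟶ N.N), uv ≫ N.incl = lift u v →
      ((bcFunctor k L).map uv ≫ e.hom) ≫ N'.incl = lift ((bcFunctor k L).map u) ((bcFunctor k L).map v) := by
    intro u v uv huv
    rw [Category.assoc, he', ← Functor.map_comp_assoc, huv, ← Functor.Monoidal.lift_μ, Category.assoc,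
      Functor.Monoidal.μ_δ, Category.comp_id]
  have key := h _ _ _ _ _ _ (hpt a b ab hab) (hpt b c bc hbc) (hpt a c ac hac)
  simp only [Category.assoc, Iso.hom_inv_id_assoc, ← Functor.map_comp] at key
  refine bcFunctor_map_injective L ?_
  rw [Functor.map_mul]
  exact key

end Descent

/-! ## The theorem -/

/-- **[Liu2021, §2.1] Every Albanese datum of a smooth projective scheme over a subfield of `ℂ` is a cocycle.**  For a
field `k` of characteristic zero with `[Algebra k ℂ]`, a `k`-scheme `X` smooth of relative dimension `d` and projective,
and ANY `aX : AppendixC.Albanese X` (Def. 2.3), the Albanese morphism satisfies `α(a,b) · α(b,c) = α(a,c)` on all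
`T`-points of `∇X` (`Albanese.IsCocycle`).  Proof: split over a finite Galois `L / k`
(`exists_isGalois_isColimit_isSmoothProjective`), cocycle for a datum of `X_L` (`Albanese.isCocycle_of_isColimit` with
`Albanese.nonempty_of_isColimit_of_algebra_complex`), `(∇X)_L ≅ ∇(X_L)` over `X_L × X_L`
(`Nabla.exists_of_nabla_baseChange_incl`), transport to every diagonal-killing morphism over `L`
(`Albanese.IsCocycle.isCocycle_of_diag_comp`) and descent (`Nabla.IsCocycle.of_baseChange`).  Ours.
[cite: Liu2021, §2.1 Proposition with proof (l. 1190–1200), Def. 2.3 (l. 1202–1208)]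
[cite: Milne1986JacobianVarieties, Remark 1.9, §6 Prop. 6.4, Remark 6.5] -/
theorem Albanese.isCocycle_of_isProjectiveOver {k : Type} [Field k] [CharZero k] [Algebra k ℂ] {d : ℕ}
    {X : SchemeOver k} [SmoothOfRelativeDimension d X.hom] (hX : IsProjectiveOver X) (aX : Albanese X) :
    aX.IsCocycle := by
  obtain ⟨L, _, _, _, _, C, _, E, inj, hE, ⟨hcol⟩⟩ :=
    exists_isGalois_isColimit_isSmoothProjective (d := d) X hX
  haveI : Fintype C := Fintype.ofFinite C
  letI : Algebra L ℂ := ((IsAlgClosed.lift : L →ₐ[k] ℂ) : L →+* ℂ).toAlgebra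
  -- a cocycle Albanese datum of `X_L`
  obtain ⟨a'⟩ := Albanese.nonempty_of_isColimit_of_algebra_complex hcol (d := fun _ => d) hE
  have ha' : a'.IsCocycle := a'.isCocycle_of_isColimit hcol
    (fun c => (nonempty_jacobian_of_isSmoothProjective_of_algebra_complex (hE c)).some)
    fun c => (hE c).geometricallyIrreducible
  -- `(∇X)_L ≅ ∇(X_L)` over `X_L × X_L`, for a descended carrier `N₀`
  obtain ⟨N₀, e, he, hediag⟩ := Nabla.exists_of_nabla_baseChange_incl L a'.nabla
  -- reduce to the carrier `N₀`
  set β₀ : N₀.N ⟶ aX.Alb.X := N₀.map aX.nabla (𝟙 X) ≫ aX.α with hβ₀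
  suffices h0 : N₀.IsCocycle β₀ by
    have hα : aX.α = aX.nabla.map N₀ (𝟙 X) ≫ β₀ := by
      rw [hβ₀, ← Category.assoc, ← Nabla.map_comp, Category.comp_id, Nabla.map_id, Category.id_comp]
    change aX.nabla.IsCocycle aX.α
    rw [hα]
    exact h0.comp_map aX.nabla (𝟙 X)
  have hβ₀1 : N₀.diag ≫ β₀ = 1 := by
    rw [hβ₀, ← Category.assoc, Nabla.diag_map, Category.id_comp, aX.diag_α]
  refine Nabla.IsCocycle.of_baseChange L N₀ β₀ a'.nabla e he (ha'.isCocycle_of_diag_comp a'.nabla _ ?_)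
  rw [← hediag, Category.assoc, Iso.hom_inv_id_assoc, ← Functor.map_comp, hβ₀1]
  exact Functor.map_one _

end Literature.NumberTheory.Automorphic.Liu2021.AppendixC

end
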